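import Summits.BirchSwinnertonDyer.BirchSwinnertonDyer.Theorems.QuadraticBranchSignedControlPlusEtaNonsurjThetaFunctionalEquationOneZero
import Mathlib.RingTheory.PowerSeries.Derivative
import HarnessLib

/-!
# Route `QuadraticBranchSignedControl` (rung K8, cell `bsd-potss`), residual crux `PlusEtaMainConjectureNonsurj`
# (stmt-BirchSwinnertonDyer-19606): THE FUNCTIONAL EQUATION ON THE QUADRATIC BRANCH, XX — HENSEL'S LEMMA FOR `Λ = ℤ_p⟦T⟧` ON THE OPEN
# DISC: `‖L(a₀)‖ < ‖L′(a₀)‖²` ⇒ a zero of `L`; a FINITE VALUE CERTIFICATE `(L̃ mod (p^k, T^M), a₀)` for the 19601 shape (seat `bsd-potss-k8eta-c2` g29; kernel)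

WHY. Part XIX turned k8eta-c1's per-pair analytic shape `hshape` (`Lη = u·T^r·(T−c₁)(T−c₂)`) into a theorem schema whose last input is
ONE zero `t ≠ 0` of `Lη` in the open disc, or a Hensel datum on the WEIERSTRASS POLYNOMIAL `P`. But `P` is not what a computation displays —
the computable objects are VALUES of `L` and of its formal derivative `L′ = dL/dT` at points `a₀ ∈ pℤ_p` (finite sums mod `p^k` of the
displayed coefficients). THIS FILE moves Hensel's lemma from `P` to `L` itself: (§56) values of the formal derivative (Mathlib
`PowerSeries.derivative`, Leibniz) — for `L = P·U`, `L(a₀) = P(a₀)U(a₀)`, `L′(a₀) = P′(a₀)U(a₀) + P(a₀)U′(a₀)`, `‖U(a₀)‖ = 1`; (§57) **HENSEL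
FOR `Λ`: `L = P·U` (`μ(L) = 0`), `‖L(a₀)‖ < ‖L′(a₀)‖²` ⇒ `‖P(a₀)‖ = ‖L(a₀)‖`, `‖P′(a₀)‖ = ‖L′(a₀)‖` (ultrametric: the cross term
`P(a₀)U′(a₀)` is smaller) ⇒ a zero `t` of `L` with `‖t − a₀‖ < ‖L′(a₀)‖`; with `‖L′(a₀)‖ ≤ ‖a₀‖ < 1` the zero is `≠ 0` and in the open disc**;
hence `hshape` from (`μ = 0`, `λ = r + 2`, `ord_T = r`, ONE value pair); (§58) **THE FINITE CERTIFICATE: if `L = L̃ + p^k·D + T^M·G` (`L̃` the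
displayed truncation — a polynomial with the coefficients of `L` mod `p^k` up to degree `< M`), then `‖L(a₀) − L̃(a₀)‖ ≤ max(p^{−k}, ‖a₀‖^M)` and
`‖L′(a₀) − L̃′(a₀)‖ ≤ max(p^{−k}, ‖a₀‖^{M−1})`, so displayed margins `‖L̃(a₀)‖ < ‖L̃′(a₀)‖²`, `max(p^{−k}, ‖a₀‖^{M−1}) < ‖L̃′(a₀)‖²` transfer
the Hensel hypotheses to `L`** — a per-pair certificate = (`k`, `M`, `L̃`, `a₀`) with three checkable inequalities of rational numbers; (§59)
rows: 19601's `hshape` (+ the partner relation) from such a certificate. The source of `L ≡ L̃`: the lineage's quotient / wide readings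
(g26 `…PlusCoeffCongruenceQuotient`: `coeff_j ℓ_m ≡ ε·coeff_j M⁺ (mod p^m)`, `j ≤ p(p−1)`), by name, for the consumer to plug in.

WHAT. §56 `evalHom_derivative_coe`, `evalHom_derivative_mul`, `norm_evalHom_le_one`; §57 **`exists_zero_of_hensel_series`**,
`feShape_of_hensel_series`, `feShape_of_mu_eq_zero_of_lam_of_hensel_series`; §58 `norm_evalHom_X_pow_mul_le`, `norm_evalHom_C_pow_mul_le`,
`norm_evalHom_sub_le_of_truncation`, `derivative_truncation_eq`, `norm_evalHom_derivative_sub_le_of_truncation`,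
**`hensel_hypotheses_of_certificate`**; §59 `feShape_plus_row_of_hensel_series`, `feShape_plus_row_of_certificate`.

HONEST FRAMING (cell `bsd-potss`; FULL-BSD rank ≤ 1 programme, HUMAN RULING D-0036/D-0074): TOOL THEOREMS ONLY — no definition, no named
fact, no `sorry`, axioms standard; nothing about (A), (C1⁺_η), (E⁺_η), C-cc-1 or `BSD(W,p)` of any pair is claimed; the certificate is
supplied here for NO pair; crux and route OPEN; nothing booked. `--supports stmt-BirchSwinnertonDyer-19606`.

References: Hensel's lemma (Mathlib `hensels_lemma`); [Washington1997] §7.1; [Kobayashi2003] Thm. 3.2; [GreenbergLNM1716] §5 (p. 181).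
Tree: Parts XV, XIX; `PadicSeriesEvaluation.lean`.
-/

set_option autoImplicit false
set_option linter.dupNamespace false
noncomputable section

open scoped Classical MatrixGroups ModularForm

open CongruenceSubgroup WeierstrassCurve Literature.NumberTheory.EllipticCurves
  Literature.NumberTheory.EllipticCurves.ModularForms
open Literature.NumberTheory.EllipticCurves.IwasawaAlgebra
open Summit.BirchSwinnertonDyer.Rank1Residual.Additive
open Summit.BirchSwinnertonDyer.Rank1Residual.X1.MuLambda (mu lam)

namespace Summit.BirchSwinnertonDyer.BirchSwinnertonDyer.Theorems.EtaThetaFunctionalEquation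

variable {p : ℕ} [hp : Fact p.Prime]

/-! ## §56 Values of the formal derivative -/

omit hp in
/-- On a polynomial the formal derivative of `Λ` evaluates to the value of the polynomial derivative. [folklore] -/
theorem evalHom_derivative_coe [Fact p.Prime] {t : ℤ_[p]} (ht : ‖t‖ < 1) (P : Polynomial ℤ_[p]) :
    evalHom t ht (PowerSeries.derivative ℤ_[p] (P : IwasawaAlgebra p)) = (Polynomial.derivative P).eval t := by
  rw [PowerSeries.derivative_coe, evalHom_coe_polynomial]

omit hp in
/-- Leibniz at a point: `(FG)′(t) = F(t)G′(t) + G(t)F′(t)`. [folklore] -/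
theorem evalHom_derivative_mul [Fact p.Prime] {t : ℤ_[p]} (ht : ‖t‖ < 1) (F G : IwasawaAlgebra p) :
    evalHom t ht (PowerSeries.derivative ℤ_[p] (F * G)) =
      evalHom t ht F * evalHom t ht (PowerSeries.derivative ℤ_[p] G) + evalHom t ht G * evalHom t ht (PowerSeries.derivative ℤ_[p] F) := by
  rw [Derivation.leibniz, map_add, smul_eq_mul, smul_eq_mul, map_mul, map_mul]

omit hp in
/-- Values lie in `ℤ_p`: `‖F(t)‖ ≤ 1`. [folklore] -/
theorem norm_evalHom_le_one [Fact p.Prime] {t : ℤ_[p]} (ht : ‖t‖ < 1) (F : IwasawaAlgebra p) : ‖evalHom t ht F‖ ≤ 1 :=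
  PadicInt.norm_le_one _

/-! ## §57 Hensel's lemma for `Λ` on the open disc -/

/-- **HENSEL'S LEMMA FOR `Λ = ℤ_p⟦T⟧`.** If `L = P·U` (`P ∈ ℤ_p[T]`, `U ∈ Λˣ` — e.g. the Weierstrass datum of an `L` with `μ(L) = 0`),
`a₀ ∈ pℤ_p`, **`‖L(a₀)‖ < ‖L′(a₀)‖²`** and `‖L′(a₀)‖ ≤ ‖a₀‖`, then `L` has a zero `t ≠ 0` in the open disc. (Transfer to `P`:
`‖P(a₀)‖ = ‖L(a₀)‖` and `‖P′(a₀)‖ = ‖L′(a₀)‖` since `‖P(a₀)U′(a₀)‖ ≤ ‖L(a₀)‖ < ‖L′(a₀)‖`; then Mathlib's `hensels_lemma`.) [folklore] -/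
theorem exists_zero_of_hensel_series {P : Polynomial ℤ_[p]} {U L : IwasawaAlgebra p} (hU : IsUnit U)
    (hL : L = (P : IwasawaAlgebra p) * U) {a₀ : ℤ_[p]} (ha₀ : ‖a₀‖ < 1)
    (hnorm : ‖evalHom a₀ ha₀ L‖ < ‖evalHom a₀ ha₀ (PowerSeries.derivative ℤ_[p] L)‖ ^ 2)
    (hder : ‖evalHom a₀ ha₀ (PowerSeries.derivative ℤ_[p] L)‖ ≤ ‖a₀‖) :
    ∃ (t : ℤ_[p]) (ht : ‖t‖ < 1), t ≠ 0 ∧ evalHom t ht L = 0 := by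
  have hUv : ‖evalHom a₀ ha₀ U‖ = 1 := PadicInt.isUnit_iff.mp (hU.map (evalHom a₀ ha₀))
  have hLv : evalHom a₀ ha₀ L = P.eval a₀ * evalHom a₀ ha₀ U := by rw [hL, map_mul, evalHom_coe_polynomial]
  have hL'v : evalHom a₀ ha₀ (PowerSeries.derivative ℤ_[p] L) =
      (Polynomial.derivative P).eval a₀ * evalHom a₀ ha₀ U +
        P.eval a₀ * evalHom a₀ ha₀ (PowerSeries.derivative ℤ_[p] U) := by
    rw [hL, evalHom_derivative_mul, evalHom_coe_polynomial, evalHom_derivative_coe]; ring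
  set A : ℤ_[p] := (Polynomial.derivative P).eval a₀ * evalHom a₀ ha₀ U with hAdef
  set B : ℤ_[p] := P.eval a₀ * evalHom a₀ ha₀ (PowerSeries.derivative ℤ_[p] U) with hBdef
  have hPv : ‖P.eval a₀‖ = ‖evalHom a₀ ha₀ L‖ := by rw [hLv, norm_mul, hUv, mul_one]
  have hAB1 : ‖A + B‖ ≤ 1 := PadicInt.norm_le_one _
  have h1 : ‖evalHom a₀ ha₀ L‖ < ‖A + B‖ := by
    refine hnorm.trans_le ?_
    rw [hL'v, sq]
    exact mul_le_of_le_one_left (norm_nonneg _) hAB1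
  have hB : ‖B‖ < ‖A + B‖ := by
    calc ‖B‖ = ‖P.eval a₀‖ * ‖evalHom a₀ ha₀ (PowerSeries.derivative ℤ_[p] U)‖ := norm_mul _ _
      _ ≤ ‖P.eval a₀‖ * 1 := by gcongr; exact PadicInt.norm_le_one _
      _ < ‖A + B‖ := by rw [mul_one, hPv]; exact h1
  have hA : ‖A‖ = ‖A + B‖ := by
    have hne : ‖A + B‖ ≠ ‖-B‖ := by rw [norm_neg]; exact hB.ne'
    have h := PadicInt.norm_add_eq_max_of_ne hne
    rw [add_neg_cancel_right, norm_neg, max_eq_left hB.le] at h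
    exact h
  have hP'v : ‖(Polynomial.derivative P).eval a₀‖ = ‖A + B‖ := by rw [← hA, hAdef, norm_mul, hUv, mul_one]
  have hn : ‖P.eval a₀‖ < ‖(Polynomial.derivative P).eval a₀‖ ^ 2 := by rw [hPv, hP'v, ← hL'v]; exact hnorm
  have hd : ‖(Polynomial.derivative P).eval a₀‖ ≤ ‖a₀‖ := by rw [hP'v, ← hL'v]; exact hder
  exact exists_zero_of_hensel (a := 1) (U := U) (by rw [map_one, one_mul, hL]) ha₀ hn hd

/-- **`hshape` FROM A VALUE PAIR**: `L = P·U` (`P` distinguished of degree `r + 2`, `U ∈ Λˣ`), `coeff_j L = 0 (j < r)`, `coeff_r L ≠ 0`,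
`‖L(a₀)‖ < ‖L′(a₀)‖²`, `‖L′(a₀)‖ ≤ ‖a₀‖ < 1` ⇒ `∃ u c₁ c₂, IsUnit u ∧ p∣c₁ ∧ p∣c₂ ∧ c₁ ≠ 0 ∧ c₂ ≠ 0 ∧ L = u·T^r·(T−c₁)(T−c₂)`.
[cite: Washington1997, §7.1 (Thm. 7.3)] -/
theorem feShape_of_hensel_series {P : Polynomial ℤ_[p]} (hP : P.IsDistinguishedAt (IsLocalRing.maximalIdeal ℤ_[p]))
    {U : IwasawaAlgebra p} (hU : IsUnit U) {L : IwasawaAlgebra p} (hL : L = (P : IwasawaAlgebra p) * U) {r : ℕ}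
    (hdeg : P.natDegree = r + 2) (hz : ∀ j, j < r → PowerSeries.coeff j L = 0) (hr : PowerSeries.coeff r L ≠ 0)
    {a₀ : ℤ_[p]} (ha₀ : ‖a₀‖ < 1) (hnorm : ‖evalHom a₀ ha₀ L‖ < ‖evalHom a₀ ha₀ (PowerSeries.derivative ℤ_[p] L)‖ ^ 2)
    (hder : ‖evalHom a₀ ha₀ (PowerSeries.derivative ℤ_[p] L)‖ ≤ ‖a₀‖) :
    ∃ (u : IwasawaAlgebra p) (c₁ c₂ : ℤ_[p]), IsUnit u ∧ (p : ℤ_[p]) ∣ c₁ ∧ (p : ℤ_[p]) ∣ c₂ ∧ c₁ ≠ 0 ∧ c₂ ≠ 0 ∧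
      L = u * PowerSeries.X ^ r * ((PowerSeries.X - PowerSeries.C c₁) * (PowerSeries.X - PowerSeries.C c₂)) := by
  obtain ⟨t, ht, ht0, hLt⟩ := exists_zero_of_hensel_series hU hL ha₀ hnorm hder
  exact feShape_of_weierstrass_of_zero hP hU hL hdeg hz hr ht ht0 hLt

/-- **Tree currency**: `L ≠ 0`, `μ(L) = 0`, `λ(L) = r + 2`, `coeff_j L = 0 (j < r)`, `coeff_r L ≠ 0`, and ONE value pair `‖L(a₀)‖ < ‖L′(a₀)‖²`,
`‖L′(a₀)‖ ≤ ‖a₀‖ < 1` ⇒ the `hshape` existential. [cite: Washington1997, §7.1 (Thm. 7.3)] -/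
theorem feShape_of_mu_eq_zero_of_lam_of_hensel_series {L : IwasawaAlgebra p} (hL0 : L ≠ 0) (hmu : mu L = 0) {r : ℕ}
    (hlam : lam L = r + 2) (hz : ∀ j, j < r → PowerSeries.coeff j L = 0) (hr : PowerSeries.coeff r L ≠ 0)
    {a₀ : ℤ_[p]} (ha₀ : ‖a₀‖ < 1) (hnorm : ‖evalHom a₀ ha₀ L‖ < ‖evalHom a₀ ha₀ (PowerSeries.derivative ℤ_[p] L)‖ ^ 2)
    (hder : ‖evalHom a₀ ha₀ (PowerSeries.derivative ℤ_[p] L)‖ ≤ ‖a₀‖) :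
    ∃ (u : IwasawaAlgebra p) (c₁ c₂ : ℤ_[p]), IsUnit u ∧ (p : ℤ_[p]) ∣ c₁ ∧ (p : ℤ_[p]) ∣ c₂ ∧ c₁ ≠ 0 ∧ c₂ ≠ 0 ∧
      L = u * PowerSeries.X ^ r * ((PowerSeries.X - PowerSeries.C c₁) * (PowerSeries.X - PowerSeries.C c₂)) := by
  obtain ⟨P, U, hP, hU, hdeg, hLP⟩ := exists_weierstrass_of_ne_zero hL0
  rw [hmu, pow_zero, map_one, one_mul] at hLP
  exact feShape_of_hensel_series hP hU hLP (hdeg.trans hlam) hz hr ha₀ hnorm hder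

/-! ## §58 The finite certificate: values of `L` and `L′` from a truncation `L = L̃ + p^k·D + T^M·G` -/

omit hp in
/-- Tail bound: `‖(T^M·G)(t)‖ ≤ ‖t‖^M`. [folklore] -/
theorem norm_evalHom_X_pow_mul_le [Fact p.Prime] {t : ℤ_[p]} (ht : ‖t‖ < 1) (M : ℕ) (G : IwasawaAlgebra p) :
    ‖evalHom t ht (PowerSeries.X ^ M * G)‖ ≤ ‖t‖ ^ M := by
  rw [map_mul, map_pow, evalHom_X_eq ht, norm_mul, norm_pow]
  exact mul_le_of_le_one_right (pow_nonneg (norm_nonneg _) _) (PadicInt.norm_le_one _)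

/-- Precision bound: `‖(p^k·D)(t)‖ ≤ p^{−k}`. [folklore] -/
theorem norm_evalHom_C_pow_mul_le {t : ℤ_[p]} (ht : ‖t‖ < 1) (k : ℕ) (D : IwasawaAlgebra p) :
    ‖evalHom t ht (PowerSeries.C ((p : ℤ_[p]) ^ k) * D)‖ ≤ (p : ℝ) ^ (-(k : ℤ)) := by
  rw [map_mul, evalHom_C_eq ht, norm_mul, PadicInt.norm_p_pow]
  exact mul_le_of_le_one_right (zpow_nonneg (Nat.cast_nonneg _) _) (PadicInt.norm_le_one _)

/-- **Values from a truncation**: `L = L̃ + p^k·D + T^M·G` ⇒ `‖L(t) − L̃(t)‖ ≤ max(p^{−k}, ‖t‖^M)`. [folklore] -/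
theorem norm_evalHom_sub_le_of_truncation {t : ℤ_[p]} (ht : ‖t‖ < 1) {L Lt D G : IwasawaAlgebra p} {k M : ℕ}
    (hL : L = Lt + PowerSeries.C ((p : ℤ_[p]) ^ k) * D + PowerSeries.X ^ M * G) :
    ‖evalHom t ht L - evalHom t ht Lt‖ ≤ max ((p : ℝ) ^ (-(k : ℤ))) (‖t‖ ^ M) := by
  rw [hL, map_add, map_add, add_assoc, add_sub_cancel_left]
  refine (PadicInt.nonarchimedean _ _).trans (max_le_max (norm_evalHom_C_pow_mul_le ht k D) (norm_evalHom_X_pow_mul_le ht M G))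

omit hp in
/-- The derivative of a truncation identity: `L = L̃ + p^k·D + T^M·G` (`M ≥ 1`) ⇒
`L′ = L̃′ + p^k·D′ + T^{M−1}·(T·G′ + M·G)`. [folklore] -/
theorem derivative_truncation_eq [Fact p.Prime] {L Lt D G : IwasawaAlgebra p} {k M : ℕ} (hM : 1 ≤ M)
    (hL : L = Lt + PowerSeries.C ((p : ℤ_[p]) ^ k) * D + PowerSeries.X ^ M * G) :
    PowerSeries.derivative ℤ_[p] L = PowerSeries.derivative ℤ_[p] Lt +
      PowerSeries.C ((p : ℤ_[p]) ^ k) * PowerSeries.derivative ℤ_[p] D +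
      PowerSeries.X ^ (M - 1) * (PowerSeries.X * PowerSeries.derivative ℤ_[p] G + (M : IwasawaAlgebra p) * G) := by
  have hXM : (PowerSeries.X : IwasawaAlgebra p) ^ M = PowerSeries.X ^ (M - 1) * PowerSeries.X := by
    rw [← pow_succ, Nat.sub_add_cancel hM]
  rw [hL, map_add, map_add, Derivation.leibniz, Derivation.leibniz, PowerSeries.derivative_C, smul_zero, add_zero,
    Derivation.leibniz_pow, PowerSeries.derivative_X, smul_eq_mul, smul_eq_mul, smul_eq_mul, nsmul_eq_mul, hXM]
  ring

/-- **Derivative values from a truncation**: `‖L′(t) − L̃′(t)‖ ≤ max(p^{−k}, ‖t‖^{M−1})` (`M ≥ 1`). [folklore] -/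
theorem norm_evalHom_derivative_sub_le_of_truncation {t : ℤ_[p]} (ht : ‖t‖ < 1) {L Lt D G : IwasawaAlgebra p} {k M : ℕ}
    (hM : 1 ≤ M) (hL : L = Lt + PowerSeries.C ((p : ℤ_[p]) ^ k) * D + PowerSeries.X ^ M * G) :
    ‖evalHom t ht (PowerSeries.derivative ℤ_[p] L) - evalHom t ht (PowerSeries.derivative ℤ_[p] Lt)‖ ≤
      max ((p : ℝ) ^ (-(k : ℤ))) (‖t‖ ^ (M - 1)) :=
  norm_evalHom_sub_le_of_truncation ht (derivative_truncation_eq hM hL)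

/-- **THE FINITE CERTIFICATE.** `L = L̃ + p^k·D + T^M·G` (`M ≥ 1`; `L̃` the displayed truncation), `a₀` in the open disc, and the three
DISPLAYED inequalities `max(p^{−k}, ‖a₀‖^{M−1}) < ‖L̃′(a₀)‖`, `max(‖L̃(a₀)‖, p^{−k}, ‖a₀‖^M) < ‖L̃′(a₀)‖²`, `‖L̃′(a₀)‖ ≤ ‖a₀‖` ⇒ the Hensel
hypotheses for `L` ITSELF: `‖L(a₀)‖ < ‖L′(a₀)‖²`, `‖L′(a₀)‖ ≤ ‖a₀‖` (indeed `‖L′(a₀)‖ = ‖L̃′(a₀)‖`). [folklore] -/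
theorem hensel_hypotheses_of_certificate {a₀ : ℤ_[p]} (ha₀ : ‖a₀‖ < 1) {L Lt D G : IwasawaAlgebra p} {k M : ℕ} (hM : 1 ≤ M)
    (hL : L = Lt + PowerSeries.C ((p : ℤ_[p]) ^ k) * D + PowerSeries.X ^ M * G)
    (h1 : max ((p : ℝ) ^ (-(k : ℤ))) (‖a₀‖ ^ (M - 1)) < ‖evalHom a₀ ha₀ (PowerSeries.derivative ℤ_[p] Lt)‖)
    (h2 : max ‖evalHom a₀ ha₀ Lt‖ (max ((p : ℝ) ^ (-(k : ℤ))) (‖a₀‖ ^ M)) < ‖evalHom a₀ ha₀ (PowerSeries.derivative ℤ_[p] Lt)‖ ^ 2)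
    (h3 : ‖evalHom a₀ ha₀ (PowerSeries.derivative ℤ_[p] Lt)‖ ≤ ‖a₀‖) :
    ‖evalHom a₀ ha₀ L‖ < ‖evalHom a₀ ha₀ (PowerSeries.derivative ℤ_[p] L)‖ ^ 2 ∧
      ‖evalHom a₀ ha₀ (PowerSeries.derivative ℤ_[p] L)‖ ≤ ‖a₀‖ ∧
      ‖evalHom a₀ ha₀ (PowerSeries.derivative ℤ_[p] L)‖ = ‖evalHom a₀ ha₀ (PowerSeries.derivative ℤ_[p] Lt)‖ := by
  set x := evalHom a₀ ha₀ (PowerSeries.derivative ℤ_[p] L) with hx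
  set y := evalHom a₀ ha₀ (PowerSeries.derivative ℤ_[p] Lt) with hy
  have hdiff : ‖x - y‖ < ‖y‖ := (norm_evalHom_derivative_sub_le_of_truncation ha₀ hM hL).trans_lt h1
  have heq : ‖x‖ = ‖y‖ := by
    have hne : ‖y‖ ≠ ‖x - y‖ := hdiff.ne'
    have h := PadicInt.norm_add_eq_max_of_ne hne
    rw [add_sub_cancel, max_eq_left hdiff.le] at h
    exact h
  have hval : ‖evalHom a₀ ha₀ L‖ < ‖y‖ ^ 2 := by
    have hd := norm_evalHom_sub_le_of_truncation ha₀ hL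
    have h := PadicInt.nonarchimedean (evalHom a₀ ha₀ Lt) (evalHom a₀ ha₀ L - evalHom a₀ ha₀ Lt)
    rw [add_sub_cancel] at h
    exact (h.trans (max_le_max le_rfl hd)).trans_lt h2
  exact ⟨by rw [heq]; exact hval, by rw [heq]; exact h3, heq⟩

/-! ## §59 On the quadratic branch: the 19601 `hshape` (with the partner) from a value pair / a finite certificate -/

section Row

variable {N : ℕ} [NeZero N] {f : CuspForm (Gamma0 N) 2}

/-- **AT A ROW (plus): `hshape` WITH THE PARTNER FROM ONE VALUE PAIR.** `V` globally minimal, good at `p ≥ 5`, `a_p(V) = 0`, `f` its newform,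
any `ϖ`, `Lη = P·U` a plus branch function (`P` distinguished of degree `r + 2`, `U ∈ Λˣ`), `coeff_j Lη = 0 (j < r)`, `coeff_r Lη ≠ 0`,
`‖Lη(a₀)‖ < ‖Lη′(a₀)‖²`, `‖Lη′(a₀)‖ ≤ ‖a₀‖ < 1` ⇒ `Lη = u·T^r·(T − c₁)(T − c₂)`, `u ∈ Λˣ`, `c_i ∈ pℤ_p ∖ {0}`, `(1+c₁)(1+c₂) = 1`.
[cite: Washington1997, §7.1 (Thm. 7.3)] [cite: GreenbergLNM1716, §5 (p. 181)] [cite: Kobayashi2003, Thm. 3.2, (3.4)] -/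
theorem feShape_plus_row_of_hensel_series (hp5 : 5 ≤ p) (V : WeierstrassCurve ℚ) [V.IsElliptic] [V.IsGloballyMinimal]
    (hgood : V.HasGoodReductionAtPrime p) (hap : V.frobeniusTrace p = 0) (hf : IsNewformOf V f) (ϖ : ℚ) {Lη : IwasawaAlgebra p}
    (hL : IsQuadraticBranchPlusLFunction f p ϖ Lη) {P : Polynomial ℤ_[p]} (hP : P.IsDistinguishedAt (IsLocalRing.maximalIdeal ℤ_[p]))
    {U : IwasawaAlgebra p} (hU : IsUnit U) (hLP : Lη = (P : IwasawaAlgebra p) * U) {r : ℕ} (hdeg : P.natDegree = r + 2)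
    (hz : ∀ j, j < r → PowerSeries.coeff j Lη = 0) (hr : PowerSeries.coeff r Lη ≠ 0)
    {a₀ : ℤ_[p]} (ha₀ : ‖a₀‖ < 1) (hnorm : ‖evalHom a₀ ha₀ Lη‖ < ‖evalHom a₀ ha₀ (PowerSeries.derivative ℤ_[p] Lη)‖ ^ 2)
    (hder : ‖evalHom a₀ ha₀ (PowerSeries.derivative ℤ_[p] Lη)‖ ≤ ‖a₀‖) :
    ∃ (u : IwasawaAlgebra p) (c₁ c₂ : ℤ_[p]), IsUnit u ∧ (p : ℤ_[p]) ∣ c₁ ∧ (p : ℤ_[p]) ∣ c₂ ∧ c₁ ≠ 0 ∧ c₂ ≠ 0 ∧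
      (1 + c₁) * (1 + c₂) = 1 ∧
      Lη = u * PowerSeries.X ^ r * ((PowerSeries.X - PowerSeries.C c₁) * (PowerSeries.X - PowerSeries.C c₂)) := by
  obtain ⟨t, ht, ht0, hLt⟩ := exists_zero_of_hensel_series hU hLP ha₀ hnorm hder
  obtain ⟨u, c₂, hu, htp, hc₂, hc₂0, h1, hLs⟩ := feShape_plus_row_of_zero hp5 V hgood hap hf ϖ hL hP hU hLP hdeg hz hr ht ht0 hLt
  exact ⟨u, t, c₂, hu, htp, hc₂, ht0, hc₂0, h1, hLs⟩

/-- **AT A ROW (plus): `hshape` WITH THE PARTNER FROM A FINITE CERTIFICATE** `(k, M, L̃, a₀)`: `Lη = L̃ + p^k·D + T^M·G` and the three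
displayed inequalities of `hensel_hypotheses_of_certificate`. [cite: Washington1997, §7.1 (Thm. 7.3)] [cite: GreenbergLNM1716, §5 (p. 181)]
[cite: Kobayashi2003, Thm. 3.2, (3.4)] -/
theorem feShape_plus_row_of_certificate (hp5 : 5 ≤ p) (V : WeierstrassCurve ℚ) [V.IsElliptic] [V.IsGloballyMinimal]
    (hgood : V.HasGoodReductionAtPrime p) (hap : V.frobeniusTrace p = 0) (hf : IsNewformOf V f) (ϖ : ℚ) {Lη : IwasawaAlgebra p}
    (hL : IsQuadraticBranchPlusLFunction f p ϖ Lη) {P : Polynomial ℤ_[p]} (hP : P.IsDistinguishedAt (IsLocalRing.maximalIdeal ℤ_[p]))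
    {U : IwasawaAlgebra p} (hU : IsUnit U) (hLP : Lη = (P : IwasawaAlgebra p) * U) {r : ℕ} (hdeg : P.natDegree = r + 2)
    (hz : ∀ j, j < r → PowerSeries.coeff j Lη = 0) (hr : PowerSeries.coeff r Lη ≠ 0)
    {a₀ : ℤ_[p]} (ha₀ : ‖a₀‖ < 1) {Lt D G : IwasawaAlgebra p} {k M : ℕ} (hM : 1 ≤ M)
    (htr : Lη = Lt + PowerSeries.C ((p : ℤ_[p]) ^ k) * D + PowerSeries.X ^ M * G)
    (h1 : max ((p : ℝ) ^ (-(k : ℤ))) (‖a₀‖ ^ (M - 1)) < ‖evalHom a₀ ha₀ (PowerSeries.derivative ℤ_[p] Lt)‖)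
    (h2 : max ‖evalHom a₀ ha₀ Lt‖ (max ((p : ℝ) ^ (-(k : ℤ))) (‖a₀‖ ^ M)) < ‖evalHom a₀ ha₀ (PowerSeries.derivative ℤ_[p] Lt)‖ ^ 2)
    (h3 : ‖evalHom a₀ ha₀ (PowerSeries.derivative ℤ_[p] Lt)‖ ≤ ‖a₀‖) :
    ∃ (u : IwasawaAlgebra p) (c₁ c₂ : ℤ_[p]), IsUnit u ∧ (p : ℤ_[p]) ∣ c₁ ∧ (p : ℤ_[p]) ∣ c₂ ∧ c₁ ≠ 0 ∧ c₂ ≠ 0 ∧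
      (1 + c₁) * (1 + c₂) = 1 ∧
      Lη = u * PowerSeries.X ^ r * ((PowerSeries.X - PowerSeries.C c₁) * (PowerSeries.X - PowerSeries.C c₂)) := by
  obtain ⟨hn, hd, -⟩ := hensel_hypotheses_of_certificate ha₀ hM htr h1 h2 h3
  exact feShape_plus_row_of_hensel_series hp5 V hgood hap hf ϖ hL hP hU hLP hdeg hz hr ha₀ hn hd

end Row

end Summit.BirchSwinnertonDyer.BirchSwinnertonDyer.Theorems.EtaThetaFunctionalEquation

end
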